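import Mathlib
import Summits.KontsevichZagierPeriods.Zeta5Search.CatalanQSum
import Summits.KontsevichZagierPeriods.Zeta5Search.Denom.CatalanBoxArithmetic
import HarnessLib

/-!
# ζ(5) search — bridge between the two explicit `G`-coefficients of the Catalan box (cell `pub-zeta5`; fam-denom D6 × fam-catalan)

HONEST FRAMING: systematic search; no irrationality claim unless certified.

Two files of the tree define the `G`-coefficient `Q(H,J,K,L,M)` of the five-parameter Catalan box
`J(H,J,K,L,M) = Q·G + P` by different explicit finite sums:
* `CatalanQSum.catalanQ` (fam-catalan, `Zeta5Search/CatalanQSum.lean`): the terminating `₃F₂` form of QSUM.md §1′;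
* `Denom.CatalanBox.QClosed` (fam-denom, `Zeta5Search/Denom/CatalanBoxArithmetic.lean`): the regrouped sum of CATK1.md Theorem A,
  for which `theoremA_QClosed` PROVES `2^{E₂'}·QClosed/8 ∈ ℤ` for all parameters.

This file:
1. KERNEL-CHECKS `catalanQ = QClosed` at every parameter set of the box with `H, J, K, L, M ≤ 6` (`bridgeOK_six`, `decide +kernel`,
   exact rational arithmetic; read-out `catalanQ_eq_QClosed_box6`) and along eight rays beyond the box (`bridge_rays`: diagonal `n ≤ 30`,
   C-5 members `n ≤ 10`, C-4/C-3/C-2/C-1 representatives `n ≤ 4`; corollary `QClosed_diagonal_eq_zudilin_u`);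
2. records the all-parameter identity as the statement `BridgeLaw` (OURS; a finite hypergeometric regrouping — both sums are the
   `G`-part of the same partial-fraction development, CATK1.md §1 = QSUM.md §1′ — PROVED ON PAPER, not formalised; tagged `@[conjecture]`
   like the other all-parameter laws of `CatalanQSum`);
3. PROVES the transfers `BridgeLaw → (2^{2(S+C)}·catalanQ/8 ∈ ℤ on the whole box)` (`theoremA_catalanQ_of_bridgeLaw`, from the general
   Lean theorem `theoremA_QClosed`) and `BridgeLaw → CatalanQSum.DyadicLaw` (`dyadicLaw_of_bridgeLaw`): once the regrouping identity is
   formalised, fam-catalan's conjecture node `DyadicLaw` closes by `theoremA_QClosed`.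

Nothing here concerns the arithmetic nature of `G`.
-/

namespace Summit.KontsevichZagierPeriods.Zeta5Search.Denom.CatalanBox

open Summit.KontsevichZagierPeriods.Zeta5Search.CatalanQSum

/-! ### 1. The kernel bridge on the small box -/

/-- Checker: at every parameter set of the box (`inBoxB`) with all coordinates `≤ B`, `catalanQ = QClosed`. -/
def bridgeOK (B : ℕ) : Bool :=
  (List.range (B + 1)).all fun H => (List.range (B + 1)).all fun J => (List.range (B + 1)).all fun K =>
    (List.range (B + 1)).all fun L => (List.range (B + 1)).all fun M =>
      !inBoxB H J K L M || decide (catalanQ H J K L M = QClosed H J K L M)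

/-- Soundness of the bridge checker. -/
theorem eq_of_bridgeOK {B : ℕ} (h : bridgeOK B = true) {H J K L M : ℕ} (hH : H ≤ B) (hJ : J ≤ B) (hK : K ≤ B)
    (hL : L ≤ B) (hM : M ≤ B) (hb : inBoxB H J K L M = true) : catalanQ H J K L M = QClosed H J K L M := by
  simp only [bridgeOK, List.all_eq_true, List.mem_range, Bool.or_eq_true, Bool.not_eq_true', decide_eq_true_eq] at h
  rcases h H (by omega) J (by omega) K (by omega) L (by omega) M (by omega) with h1 | h1
  · rw [h1] at hb; exact absurd hb (by decide)
  · exact h1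

/-- **Kernel computation**: the two explicit sums agree at all 6 419 parameter sets of the box with `H, J, K, L, M ≤ 6`
(exact rational arithmetic inside the kernel). -/
theorem bridgeOK_six : bridgeOK 6 = true := by
  decide +kernel

/-- **Read-out**: `catalanQ = QClosed` on the box `≤ 6`. -/
theorem catalanQ_eq_QClosed_box6 {H J K L M : ℕ} (hH : H ≤ 6) (hJ : J ≤ 6) (hK : K ≤ 6) (hL : L ≤ 6) (hM : M ≤ 6)
    (hb : inBoxB H J K L M = true) : catalanQ H J K L M = QClosed H J K L M :=
  eq_of_bridgeOK bridgeOK_six hH hJ hK hL hM hb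

/-- The box hypotheses in `Prop` form give `inBoxB = true`. -/
theorem inBoxB_of_le {H J K L M : ℕ} (h₁ : H ≤ K + L) (h₂ : J ≤ L + M) (h₃ : K ≤ M + H) (h₄ : L ≤ H + J)
    (h₅ : M + 1 ≤ J + K) : inBoxB H J K L M = true := by
  simp [inBoxB, h₁, h₂, h₃, h₄, h₅]

/-- **Rays beyond the small box** (kernel): `catalanQ = QClosed` along `n·(1,1,1,1,1)` for `n ≤ 30`, along the three C-5 members
`n·(3,4,4,3,5)`, `n·(4,4,3,4,4)`, `n·(4,3,4,4,4)` for `n ≤ 10`, and along `n·(4,5,5,4,6)`, `n·(4,5,5,5,6)`, `n·(6,6,7,7,8)`,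
`n·(7,7,8,8,9)` (rows C-4, C-3, C-2, C-1 of fam-catalan's table) for `n ≤ 4`. -/
theorem bridge_rays :
    (∀ n ≤ 30, catalanQ n n n n n = QClosed n n n n n)
    ∧ (∀ n ≤ 10, catalanQ (3 * n) (4 * n) (4 * n) (3 * n) (5 * n) = QClosed (3 * n) (4 * n) (4 * n) (3 * n) (5 * n))
    ∧ (∀ n ≤ 10, catalanQ (4 * n) (4 * n) (3 * n) (4 * n) (4 * n) = QClosed (4 * n) (4 * n) (3 * n) (4 * n) (4 * n))
    ∧ (∀ n ≤ 10, catalanQ (4 * n) (3 * n) (4 * n) (4 * n) (4 * n) = QClosed (4 * n) (3 * n) (4 * n) (4 * n) (4 * n))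
    ∧ (∀ n ≤ 4, catalanQ (4 * n) (5 * n) (5 * n) (4 * n) (6 * n) = QClosed (4 * n) (5 * n) (5 * n) (4 * n) (6 * n))
    ∧ (∀ n ≤ 4, catalanQ (4 * n) (5 * n) (5 * n) (5 * n) (6 * n) = QClosed (4 * n) (5 * n) (5 * n) (5 * n) (6 * n))
    ∧ (∀ n ≤ 4, catalanQ (6 * n) (6 * n) (7 * n) (7 * n) (8 * n) = QClosed (6 * n) (6 * n) (7 * n) (7 * n) (8 * n))
    ∧ (∀ n ≤ 4, catalanQ (7 * n) (7 * n) (8 * n) (8 * n) (9 * n) = QClosed (7 * n) (7 * n) (8 * n) (8 * n) (9 * n)) := by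
  refine ⟨?_, ?_, ?_, ?_, ?_, ?_, ?_, ?_⟩ <;> decide +kernel

/-- **Diagonal corollary**: for `n ≤ 30`, `QClosed(n,n,n,n,n) = 8(−1)ⁿ u_n` with Zudilin's `u_n`
(`Literature.NumberTheory.Irrationality.Zudilin2003.u`; via `CatalanQSum.diagonal_eq_zudilin_u`). -/
theorem QClosed_diagonal_eq_zudilin_u (n : ℕ) (hn : n ≤ 30) :
    QClosed n n n n n = 8 * (-1) ^ n * Literature.NumberTheory.Irrationality.Zudilin2003.u n := by
  rw [← bridge_rays.1 n hn]
  exact diagonal_eq_zudilin_u n (by omega)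

/-! ### 2. The all-parameter identity (ours, proved on paper, not formalised) -/

/-- **Bridge law** (OURS; PROVED ON PAPER — `catalanQ` (QSUM.md §1′) and `QClosed` (CATK1.md Theorem A) are two groupings of the
`G`-part of one partial-fraction development of the Catalan box; kernel-checked on the box `≤ 6` above; a Lean proof is a finite
hypergeometric regrouping, typer-sized): on the box, `catalanQ H J K L M = QClosed H J K L M`. -/
@[conjecture] def BridgeLaw : Prop :=
  ∀ H J K L M : ℕ, H ≤ K + L → J ≤ L + M → K ≤ M + H → L ≤ H + J → M + 1 ≤ J + K →
    catalanQ H J K L M = QClosed H J K L M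

/-- `BridgeLaw` restricted to the box `≤ 6` HOLDS (kernel). -/
theorem bridgeLaw_box6 : ∀ H J K L M : ℕ, H ≤ 6 → J ≤ 6 → K ≤ 6 → L ≤ 6 → M ≤ 6 →
    H ≤ K + L → J ≤ L + M → K ≤ M + H → L ≤ H + J → M + 1 ≤ J + K →
    catalanQ H J K L M = QClosed H J K L M :=
  fun _ _ _ _ _ hH hJ hK hL hM h₁ h₂ h₃ h₄ h₅ =>
    catalanQ_eq_QClosed_box6 hH hJ hK hL hM (inBoxB_of_le h₁ h₂ h₃ h₄ h₅)

/-! ### 3. Transfers of Theorem A -/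

/-- On the box the exponent `E₂'` of `theoremA_QClosed` is fam-catalan's `2(S+C)`, `S = J+K−M`, `C = K+L−H`. -/
theorem E2'_eq_two_mul {H J K L M : ℕ} (h₁ : H ≤ K + L) :
    E2' H J K L M = 2 * ((J + K - M) + (K + L - H)) := by
  unfold E2'; omega

/-- **Theorem A for `catalanQ`, conditional on the bridge**: `2^{2(S+C)}·Q/8 ∈ ℤ` at every parameter set of the box. -/
theorem theoremA_catalanQ_of_bridgeLaw (hB : BridgeLaw) {H J K L M : ℕ} (h₁ : H ≤ K + L) (h₂ : J ≤ L + M)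
    (h₃ : K ≤ M + H) (h₄ : L ≤ H + J) (h₅ : M + 1 ≤ J + K) :
    ∃ z : ℤ, (z : ℚ) = 2 ^ (2 * ((J + K - M) + (K + L - H))) * catalanQ H J K L M / 8 := by
  rw [hB H J K L M h₁ h₂ h₃ h₄ h₅, ← E2'_eq_two_mul h₁]
  exact theoremA_QClosed H J K L M

/-- **Theorem A for `catalanQ` on the box `≤ 6`, unconditionally** (bridge by kernel + the general theorem; consistent with
`CatalanQSum.lawOK_box6` (i), which obtains the same by direct kernel evaluation). -/
theorem theoremA_catalanQ_box6 {H J K L M : ℕ} (hH : H ≤ 6) (hJ : J ≤ 6) (hK : K ≤ 6) (hL : L ≤ 6) (hM : M ≤ 6)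
    (h₁ : H ≤ K + L) (h₂ : J ≤ L + M) (h₃ : K ≤ M + H) (h₄ : L ≤ H + J) (h₅ : M + 1 ≤ J + K) :
    ∃ z : ℤ, (z : ℚ) = 2 ^ (2 * ((J + K - M) + (K + L - H))) * catalanQ H J K L M / 8 := by
  rw [bridgeLaw_box6 H J K L M hH hJ hK hL hM h₁ h₂ h₃ h₄ h₅, ← E2'_eq_two_mul h₁]
  exact theoremA_QClosed H J K L M

/-- A rational of the form `z/2^e` has a power of `2` as reduced denominator. -/
theorem den_pow_two_of_eq_div {q : ℚ} {z : ℤ} {e : ℕ} (hq : q = (z : ℚ) / 2 ^ e) : ∃ e' : ℕ, q.den = 2 ^ e' := by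
  have hq' : q = Rat.divInt z ((2 ^ e : ℕ) : ℤ) := by
    rw [hq, Rat.divInt_eq_div]; push_cast; rfl
  have hd := Rat.den_dvd z ((2 ^ e : ℕ) : ℤ)
  rw [← hq'] at hd
  have hdn : q.den ∣ 2 ^ e := by exact_mod_cast hd
  obtain ⟨e', -, he'⟩ := (Nat.dvd_prime_pow Nat.prime_two).1 hdn
  exact ⟨e', he'⟩

/-- **The bridge closes fam-catalan's `DyadicLaw`**: given `BridgeLaw`, the reduced denominator of `catalanQ` on the box is a power
of `2` — by the general Lean theorem `QClosed_dyadic` (CATK1 Theorem A), no kernel computation. -/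
theorem dyadicLaw_of_bridgeLaw (hB : BridgeLaw) : DyadicLaw := by
  intro H J K L M h₁ h₂ h₃ h₄ h₅
  obtain ⟨z, e, hze⟩ := QClosed_dyadic H J K L M
  rw [hB H J K L M h₁ h₂ h₃ h₄ h₅]
  exact den_pow_two_of_eq_div hze

-- Filing note (lead/lit g11, gate `dedup.landed`): the staged file (sha256 7aa6bb0d…) also proved here
-- `dyadicLaw_box6` — `DyadicLaw` restricted to the box `≤ 6`, via the kernel bridge + `QClosed_dyadic`. That statement is
-- ALREADY in the tree verbatim as `CatalanQSum.dyadicLaw_box6` (`Zeta5Search/CatalanQSumReadout.lean`, p237989, by direct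
-- kernel evaluation), so it is not restated; use that declaration. Everything else is byte-identical to the staging.

end Summit.KontsevichZagierPeriods.Zeta5Search.Denom.CatalanBox
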